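import Literature.Analysis.FluidPDE.TorusNSStrainEquationProjected
import Literature.Analysis.FluidPDE.TorusEnstrophyStrainIdentity
import HarnessLib

/-!
# Miller's perturbative blow-up condition for Navier–Stokes on `T³`
# (Anal. PDE 16 (2023) Thm 6.1 = Pure Appl. Anal. 8 (2026) Thm 1.10), classical solutions

Analysis/FluidPDE proof file (theorems only, no definitions, no named facts).
Search for candidate a priori estimates; no regularity claim — this file types a CONDITIONAL
finite-time blow-up statement exactly as printed (a bound on the existence time under a
hypothesis on the whole history of the solution); it exhibits no solution satisfying the hypothesis.

E. Miller, *Finite-time blowup for a Navier–Stokes model equation for the self-amplification of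
strain* (arXiv title: *Blowup for a Navier–Stokes strain model equation with applications to possible
blowup for the Navier–Stokes equation*), Anal. PDE 16 (2023) 997–1032 (= arXiv:1910.05415), §6:

* **Theorem 6.1** (restated as Pure Appl. Anal. 8 (2026), Thm 1.10). "Suppose
  `u ∈ C([0,T_max);H²_{df})` is a mild solution of the Navier–Stokes equation such that
  `f₀ := −3‖S⁰‖²_{Ḣ¹} − 4∫det(S⁰) > 0` and for all `0 ≤ t < T_max`
  `‖P_{st}((u·∇)S + ⅓S² + ¼ω⊗ω)(·,t)‖_{L²} / ‖(−ΔS + P_{st}(½(u·∇)S + ⅚S² + ⅛ω⊗ω))(·,t)‖_{L²} ≤ 2`.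
  Then there is finite-time blowup with `T_max < T_* := (−E₀ + √(E₀² + f₀K₀))/f₀`", where
  `K₀ = ½‖u⁰‖²_{L²}`, `E₀ = ½‖∇u⁰‖²_{L²}`.
* Printed proof: `f(t) = −3‖S‖²_{Ḣ¹} − (4/3)∫tr(S³)` (`det S = ⅓tr(S³)` as `tr S = 0`);
  "`∂ₜf = 6⟨−ΔS + ⅔P_{st}(S²), −ΔS + P_{st}((u·∇)S + S² + ¼ω⊗ω)⟩`" [the display prints `ΔS` for the
  first `−ΔS`; the next display fixes the sign]; "`⟨M, M+Q⟩ = ‖M + ½Q‖² − ¼‖Q‖²`" gives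
  "`∂ₜf = 6‖−ΔS + P_{st}(½(u·∇)S + ⅚S² + ⅛ω⊗ω)‖² − (3/2)‖P_{st}((u·∇)S + ⅓S² + ¼ω⊗ω)‖² ≥ 0`";
  then `∂ₜE = −2‖S‖²_{Ḣ¹} − 4∫det S > f ≥ f₀`, `E(t) > E₀ + f₀t`, `∫₀ᵗE > E₀t + ½f₀t²`, contradicting
  the energy equality `∫₀^{T_*}E ≤ ½K₀` if `T_max ≥ T_*`.

Here, on the unit torus `T^d` with `card d = 3` (frame `e : d ≃ Fin 3`,
`ωₐ = W_{e⁻¹(e a+1), e⁻¹(e a+2)}`), for CLASSICAL solutions of the unforced equations with viscosity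
`ν` (`Torus.IsClassicalNSSolutionOn (Icc 0 T) ν 0 u p`; the strain equation reads
`∂ₜS = νΔS − P_{st}((u·∇)S + S² + ¼ω⊗ω)`, tree `TorusNSStrainEquationProjected`, so
`f = −3ν‖S‖²_{Ḣ¹} − (4/3)∫tr S³`, the denominator is `−νΔS + P_{st}(…)`, and
`T_* = (−E₀ + √(E₀² + f₀K₀/ν))/f₀`), in the ladder variables of the cell
(`‖S‖²_{Ḣ¹} = ½‖Δu‖₂²`, `E = torusEnstrophy = ½‖∇u‖₂²`, `K = Torus.kineticEnergy = ½‖u‖₂²`), with all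
matrix fields written out entrywise (`S_{ab} = ½((∂_a u)_b + (∂_b u)_a)`,
`((u·∇)S)_{ab} = ∑_c u_c∂_cS_{ab}`, `(S²)_{ab} = ∑_c S_{ac}S_{cb}`), we prove (theorems only):

* `StrainPerturbativeBlowup.hasDerivWithinAt_integral_trace_strain_cube` — the cubic balance
  `d/dt ∫tr(S³) = 3∫tr(S²(νΔS − P_{st}((u·∇)S + S² + ¼ω⊗ω)))` along classical solutions
  (differentiation under `∫`, product rule, cyclic symmetry, projected strain equation);
* `StrainPerturbativeBlowup.fluxDeriv_nonneg` — the slice inequality `∂ₜf ≥ 0` under the printed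
  ratio hypothesis: the identity `∂ₜf = 6⟨M, M+Q⟩ = 6‖M + ½Q‖² − (3/2)‖Q‖²` with
  `M = −νΔS + ⅔P_{st}(S²)`, `Q = P_{st}((u·∇)S + ⅓S² + ¼ω⊗ω)`, via `⟨ΔS, P_{st}·⟩ = ⟨ΔS, ·⟩`,
  `⟨ΔS, ω⊗ω⟩ = 0` (PAA Thm 1.3), self-adjointness and idempotence of `P_{st}`, linearity of `P_{st}`;
* `StrainPerturbativeBlowup.four_mul_integral_det_strain_eq` (`4∫det S = (4/3)∫tr S³` in this
  file's entry conventions);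
* **`Torus.classicalNS_kineticEnergy_add_le_of_strainPerturbative`** — the quantitative content:
  under the ratio hypothesis on `[0, T]` (any sign of `f₀`, `ν ≥ 0`),
  `K(T) + 2ν(E₀T + ½f₀T²) ≤ K₀`;
* **`Torus.classicalNS_time_le_of_strainPerturbative`** — for `ν > 0`, `f₀ > 0`:
  `T ≤ (−E₀ + √(E₀² + f₀K₀/ν))/f₀` (`= T_*` at `ν = 1`).

Scope (faithfulness): Miller's statement is for mild `H²` solutions on `ℝ³`, `ν = 1`, on the maximal
half-open interval, with the strict conclusion `T_max < T_*`; here classical solutions on a CLOSED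
interval `[0, T] × T³` with the hypothesis on all of `[0, T]`, conclusion `T ≤ T_*` (so no classical
solution carrying the hypothesis exists on `[0, T]` for `T > T_*`); all steps of the printed proof are
pointwise algebra, integrations by parts and ODE comparison, identical on the torus. The companion
Prop 6.2/Thm 6.3 of the paper (the hypothesis holds for short times for suitable data) is not typed.
Nothing about regularity of Navier–Stokes follows: the hypothesis is a condition on the entire history
of the solution which is not known to persist (Miller: "We cannot show that the perturbative condition
is satisfied up until `T_*` — if we could this would resolve the Navier–Stokes regularity problem").
These serve the functional-mining cell (pub-nsfunc): a typed blow-up-side companion of CRITERIA row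
A25 for the no-go/dictionary seats (the monotone functional `f = −3ν‖S‖²_{Ḣ¹} − 4∫det S` under the
ratio condition).

## Mathlib / tree search

Tree (used): `Torus.IsClassicalNSSolutionOn.timeDerivWithin_strain_eq`, `Torus.strainProjection_add`,
`…_sub`, `…_const_mul` (`TorusNSStrainEquationProjected`, this seat);
`Torus.IsClassicalNSSolutionOn.hasDerivWithinAt_half_laplacianSq_strainProjection`,
`StrainProjectionCriterion.integral_sum_laplacianStrain_mul_strainProjection_eq`
(`TorusNSStrainProjectionCriterion`); `Torus.integral_sum_strainProjection_mul_comm`,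
`Torus.strainProjection_strainProjection` (`TorusStrainProjection`);
`StrainVorticityOrthogonality.integral_sum_vorticity_laplacianStrain_vorticity_eq_zero`,
`StrainAlmostEigen.integral_sum_laplacianStrain_sq_eq`;
`Torus.IsClassicalNSSolutionOn.hasDerivWithinAt_torusEnstrophy_det`,
`integral_stretching_eq_four_mul_integral_det_strain`, `…_four_thirds_integral_trace_strain_cube`
(`TorusEnstrophyStrainIdentity`); `Torus.IsClassicalNSSolutionOn.energy_balance_holds`;
`IsSmoothSpaceTimeOn.hasDerivWithinAt_integral`, `timeDerivWithin_finset_sum`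
(`TorusCalculusProofs`, `TorusInverseLaplacianCalculus`); `le_mul_exp_integral_of_hasDerivWithinAt_le_mul`
(`ExtremeGrowthVorticityControl`). Searched (`lean search`): `perturbative|Blowup.*strain|det_strain` —
only the enstrophy–determinant identity and the `λ₂⁺` criteria before this file.

## References

* [Miller2023StrainModel] E. Miller, Anal. PDE 16 (2023) 997–1032 = arXiv:1910.05415: Thm 6.1 with
  proof (held text paper:arxiv-1910.05415, p. 20), eq. (1.9), Prop 1.9 (enstrophy identity).
* [Miller2026StrainVorticity] E. Miller, Pure Appl. Anal. 8 (2026) 247–270: Thm 1.10 (restatement),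
  Thm 1.3.
* [Miller2019] E. Miller, Arch. Ration. Mech. Anal. 235 (2020): Prop 2.1, Def 2.2, Prop 2.4.
-/

noncomputable section

open MeasureTheory Set Function Finset intervalIntegral

namespace Literature.Analysis.FluidPDE

open Literature.Analysis.FunctionSpaces Literature.Analysis.FunctionSpaces.Torus
  StrainProjectionCriterion StrainVorticityOrthogonality StrainEquationProjected

variable {d : Type*} [Fintype d] [DecidableEq d]

namespace StrainPerturbativeBlowup

/-! ### Smoothness and calculus helpers -/

omit [DecidableEq d] in
/-- Finite sums of smooth scalar functions are smooth. [folklore] -/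
private theorem isSmooth_sum'' {ι : Type*} (s : Finset ι) {g : ι → UnitAddTorus d → ℝ}
    (hg : ∀ i ∈ s, Torus.IsSmooth (g i)) : Torus.IsSmooth (fun x => ∑ i ∈ s, g i x) := by
  have hl : Torus.lift (fun x => ∑ i ∈ s, g i x) = fun z => ∑ i ∈ s, Torus.lift (g i) z := rfl
  unfold Torus.IsSmooth
  rw [hl]
  exact ContDiff.sum fun i hi => hg i hi

omit [DecidableEq d] in
/-- Products of smooth scalar functions are smooth (pointwise form). [folklore] -/
private theorem smooth_mul'' {a b : UnitAddTorus d → ℝ} (ha : Torus.IsSmooth a) (hb : Torus.IsSmooth b) :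
    Torus.IsSmooth (fun y => a y * b y) := ha.mul hb

omit [DecidableEq d] in
/-- Product rule for one-sided time derivatives of scalar space–time fields. [folklore] -/
private theorem timeDerivWithin_mul'' {S : Set ℝ} {A B : ℝ → UnitAddTorus d → ℝ}
    (hA : Torus.IsSmoothSpaceTimeOn S A) (hB : Torus.IsSmoothSpaceTimeOn S B) (hS : UniqueDiffOn ℝ S)
    {t : ℝ} (ht : t ∈ S) (x : UnitAddTorus d) :
    Torus.timeDerivWithin S (fun s y => A s y * B s y) t x =
      Torus.timeDerivWithin S A t x * B t x + A t x * Torus.timeDerivWithin S B t x :=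
  ((hA.hasDerivWithinAt_slice ht x).fun_mul (hB.hasDerivWithinAt_slice ht x)).derivWithin (hS t ht)

omit [DecidableEq d] in
/-- The cyclic symmetrisation behind `d/dt tr(S³) = 3 tr(S² Ṡ)`: for arrays `X`, `S` with `S`
symmetric, `∑_{abc}(X_{ab}S_{bc}S_{ca} + S_{ab}X_{bc}S_{ca} + S_{ab}S_{bc}X_{ca}) = 3∑_{ab} X_{ab}∑_c S_{ac}S_{cb}`.
[folklore] -/
private theorem sum_cyclic_eq_three_mul (X S : d → d → ℝ) (hS : ∀ a b, S a b = S b a) :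
    ∑ a, ∑ b, ∑ c, (X a b * S b c * S c a + S a b * X b c * S c a + S a b * S b c * X c a) =
      3 * ∑ a, ∑ b, X a b * ∑ c, S a c * S c b := by
  have h1 : ∑ a, ∑ b, ∑ c, X a b * S b c * S c a = ∑ a, ∑ b, X a b * ∑ c, S a c * S c b := by
    refine Finset.sum_congr rfl fun a _ => Finset.sum_congr rfl fun b _ => ?_
    rw [Finset.mul_sum]
    exact Finset.sum_congr rfl fun c _ => by rw [hS b c, hS c a]; ring
  have h2 : ∑ a, ∑ b, ∑ c, S a b * X b c * S c a = ∑ a, ∑ b, X a b * ∑ c, S a c * S c b := by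
    -- reindex `(a, b, c) ↦ (c, a, b)`
    have e : ∑ a, ∑ b, ∑ c, S a b * X b c * S c a = ∑ b, ∑ c, ∑ a, S a b * X b c * S c a := by
      rw [Finset.sum_comm]
      exact Finset.sum_congr rfl fun b _ => Finset.sum_comm
    rw [e]
    refine Finset.sum_congr rfl fun b _ => Finset.sum_congr rfl fun c _ => ?_
    rw [Finset.mul_sum]
    exact Finset.sum_congr rfl fun a _ => by rw [hS a b, hS c a]; ring
  have h3 : ∑ a, ∑ b, ∑ c, S a b * S b c * X c a = ∑ a, ∑ b, X a b * ∑ c, S a c * S c b := by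
    -- reindex `(a, b, c) ↦ (b, c, a)`
    have e : ∑ a, ∑ b, ∑ c, S a b * S b c * X c a = ∑ c, ∑ a, ∑ b, S a b * S b c * X c a := by
      have e1 : ∑ a, ∑ b, ∑ c, S a b * S b c * X c a = ∑ a, ∑ c, ∑ b, S a b * S b c * X c a :=
        Finset.sum_congr rfl fun a _ => Finset.sum_comm
      rw [e1, Finset.sum_comm]
    rw [e]
    refine Finset.sum_congr rfl fun c _ => Finset.sum_congr rfl fun a _ => ?_
    rw [Finset.mul_sum]
    exact Finset.sum_congr rfl fun b _ => by rw [hS c b, hS b a]; ring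
  simp only [Finset.sum_add_distrib]
  rw [h1, h2, h3]
  ring

variable {a b ν : ℝ} {u : ℝ → UnitAddTorus d → EuclideanSpace ℝ d} {p : ℝ → UnitAddTorus d → ℝ}

/-- The strain entries `(t, x) ↦ S_{ab}(t, x)` of a classical solution are jointly smooth. [folklore] -/
private theorem isSmoothSpaceTimeOn_strain (hu : Torus.IsSmoothSpaceTimeOn (Icc a b) u) (hab : a < b)
    (i j : d) :
    Torus.IsSmoothSpaceTimeOn (Icc a b)
      (fun s y => (Torus.partialDeriv i (u s) y j + Torus.partialDeriv j (u s) y i) / 2) := by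
  have hS : UniqueDiffOn ℝ (Icc a b) := uniqueDiffOn_Icc hab
  have hA : Torus.IsSmoothSpaceTimeOn (Icc a b) (fun s y => Torus.partialDeriv i (u s) y j) :=
    (hu.partialDeriv hS i).apply j
  have hB : Torus.IsSmoothSpaceTimeOn (Icc a b) (fun s y => Torus.partialDeriv j (u s) y i) :=
    (hu.partialDeriv hS j).apply i
  exact ContDiffOn.div_const (ContDiffOn.add hA hB) 2

/-! ### The cubic balance `d/dt ∫ tr(S³) = 3∫ tr(S² ∂ₜS)` -/

/-- **Time derivative of the cubic strain invariant along a classical solution**: on `[a, b] × T^d`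
(`card d = 3` via the frame `e`, unforced, viscosity `ν`),
`d/dt ∫ ∑_{abc} S_{ab}S_{bc}S_{ca} = 3 ∫ ∑_{ab} (S²)_{ab} (ν(ΔS)_{ab} − (P_{st}((u·∇)S + S² + ¼ω⊗ω))_{ab})`
(differentiation under the integral sign for jointly smooth fields, the product rule, the cyclic
symmetry of the trace, and the projected strain equation
`∂ₜS = νΔS − P_{st}((u·∇)S + S² + ¼ω⊗ω)`, Miller, Anal. PDE 16 (2023), (1.9); this is the step
"differentiating `f`" with `∫det S = ⅓∫tr(S³)` in the proof of Thm 6.1 there).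
[cite: Miller2023StrainModel, Thm 6.1 (proof: `∂ₜ f`, display after (6.4)) and eq. (1.9)] -/
theorem hasDerivWithinAt_integral_trace_strain_cube (e : d ≃ Fin 3)
    (h : Torus.IsClassicalNSSolutionOn (Icc a b) ν 0 u p) (hab : a < b) {t : ℝ} (ht : t ∈ Icc a b) :
    HasDerivWithinAt
      (fun s => ∫ x, ∑ i, ∑ j, ∑ k,
        ((Torus.partialDeriv i (u s) x j + Torus.partialDeriv j (u s) x i) / 2) *
        ((Torus.partialDeriv j (u s) x k + Torus.partialDeriv k (u s) x j) / 2) *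
        ((Torus.partialDeriv k (u s) x i + Torus.partialDeriv i (u s) x k) / 2))
      (3 * ∫ x, ∑ i, ∑ j,
        (ν * ((Torus.partialDeriv i (Torus.laplacian (u t)) x j +
            Torus.partialDeriv j (Torus.laplacian (u t)) x i) / 2) -
          Torus.strainProjection (fun a b x =>
            (∑ c, u t x c * Torus.partialDeriv c
                (fun y => (Torus.partialDeriv b (u t) y a + Torus.partialDeriv a (u t) y b) / 2) x) +
              (∑ c, ((Torus.partialDeriv c (u t) x a + Torus.partialDeriv a (u t) x c) / 2) *
                ((Torus.partialDeriv b (u t) x c + Torus.partialDeriv c (u t) x b) / 2)) +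
              4⁻¹ * (torusVorticityTensor (u t) (e.symm (e a + 1)) (e.symm (e a + 2)) x *
                torusVorticityTensor (u t) (e.symm (e b + 1)) (e.symm (e b + 2)) x)) i j x) *
        ∑ k, ((Torus.partialDeriv i (u t) x k + Torus.partialDeriv k (u t) x i) / 2) *
          ((Torus.partialDeriv k (u t) x j + Torus.partialDeriv j (u t) x k) / 2))
      (Icc a b) t := by
  have hS : UniqueDiffOn ℝ (Icc a b) := uniqueDiffOn_Icc hab
  have hu := h.smooth_velocity
  -- the strain entries as space–time fields
  set Sf : d → d → ℝ → UnitAddTorus d → ℝ := fun i j s y =>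
    (Torus.partialDeriv i (u s) y j + Torus.partialDeriv j (u s) y i) / 2 with hSf
  have hSfs : ∀ i j, Torus.IsSmoothSpaceTimeOn (Icc a b) (Sf i j) := fun i j =>
    isSmoothSpaceTimeOn_strain hu hab i j
  have hsym : ∀ i j s y, Sf i j s y = Sf j i s y := by
    intro i j s y; simp only [hSf]; ring
  -- the integrand `φ = tr(S³)` is jointly smooth
  set φ : ℝ → UnitAddTorus d → ℝ := fun s y => ∑ i, ∑ j, ∑ k, Sf i j s y * Sf j k s y * Sf k i s y with hφ
  have hφs : Torus.IsSmoothSpaceTimeOn (Icc a b) φ :=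
    Torus.IsSmoothSpaceTimeOn.sum fun i _ => Torus.IsSmoothSpaceTimeOn.sum fun j _ =>
      Torus.IsSmoothSpaceTimeOn.sum fun k _ => ((hSfs i j).mul (hSfs j k)).mul (hSfs k i)
  have hD := hφs.hasDerivWithinAt_integral (convex_Icc a b) ht
  have hfun : (fun s => ∫ x, ∑ i, ∑ j, ∑ k,
      ((Torus.partialDeriv i (u s) x j + Torus.partialDeriv j (u s) x i) / 2) *
      ((Torus.partialDeriv j (u s) x k + Torus.partialDeriv k (u s) x j) / 2) *
      ((Torus.partialDeriv k (u s) x i + Torus.partialDeriv i (u s) x k) / 2)) = fun s => ∫ x, φ s x := by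
    funext s; rfl
  rw [hfun]
  refine hD.congr_deriv ?_
  -- the time derivative of `φ`, pointwise
  set Sd : d → d → UnitAddTorus d → ℝ := fun i j y => Torus.timeDerivWithin (Icc a b) (Sf i j) t y with hSd
  have hderφ : ∀ y, Torus.timeDerivWithin (Icc a b) φ t y =
      3 * ∑ i, ∑ j, Sd i j y * ∑ k, Sf i k t y * Sf k j t y := by
    intro y
    have e1 : Torus.timeDerivWithin (Icc a b) φ t y =
        ∑ i, ∑ j, ∑ k, Torus.timeDerivWithin (Icc a b) (fun s z => Sf i j s z * Sf j k s z * Sf k i s z) t y := by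
      simp only [hφ]
      rw [Torus.timeDerivWithin_finset_sum _ (fun i _ => Torus.IsSmoothSpaceTimeOn.sum fun j _ =>
        Torus.IsSmoothSpaceTimeOn.sum fun k _ => ((hSfs i j).mul (hSfs j k)).mul (hSfs k i)) hS ht]
      refine Finset.sum_congr rfl fun i _ => ?_
      rw [Torus.timeDerivWithin_finset_sum _ (fun j _ =>
        Torus.IsSmoothSpaceTimeOn.sum fun k _ => ((hSfs i j).mul (hSfs j k)).mul (hSfs k i)) hS ht]
      refine Finset.sum_congr rfl fun j _ => ?_
      rw [Torus.timeDerivWithin_finset_sum _ (fun k _ => ((hSfs i j).mul (hSfs j k)).mul (hSfs k i)) hS ht]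
    rw [e1]
    have e2 : ∀ i j k, Torus.timeDerivWithin (Icc a b) (fun s z => Sf i j s z * Sf j k s z * Sf k i s z) t y =
        Sd i j y * Sf j k t y * Sf k i t y + Sf i j t y * Sd j k y * Sf k i t y +
          Sf i j t y * Sf j k t y * Sd k i y := by
      intro i j k
      rw [timeDerivWithin_mul'' ((hSfs i j).mul (hSfs j k)) (hSfs k i) hS ht,
        timeDerivWithin_mul'' (hSfs i j) (hSfs j k) hS ht]
      simp only [hSd]
      ring
    simp only [e2]
    exact sum_cyclic_eq_three_mul (fun i j => Sd i j y) (fun i j => Sf i j t y) fun i j => hsym i j t y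
  -- insert the projected strain equation for `Sd`
  have hSd_eq : ∀ i j y, Sd i j y =
      ν * ((Torus.partialDeriv i (Torus.laplacian (u t)) y j +
          Torus.partialDeriv j (Torus.laplacian (u t)) y i) / 2) -
        Torus.strainProjection (fun a b x =>
          (∑ c, u t x c * Torus.partialDeriv c
              (fun y => (Torus.partialDeriv b (u t) y a + Torus.partialDeriv a (u t) y b) / 2) x) +
            (∑ c, ((Torus.partialDeriv c (u t) x a + Torus.partialDeriv a (u t) x c) / 2) *
              ((Torus.partialDeriv b (u t) x c + Torus.partialDeriv c (u t) x b) / 2)) +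
            4⁻¹ * (torusVorticityTensor (u t) (e.symm (e a + 1)) (e.symm (e a + 2)) x *
              torusVorticityTensor (u t) (e.symm (e b + 1)) (e.symm (e b + 2)) x)) i j y := by
    intro i j y
    simp only [hSd, hSf]
    exact h.timeDerivWithin_strain_eq e hab ht i j y
  rw [← MeasureTheory.integral_const_mul]
  refine integral_congr_ae (ae_of_all _ fun y => ?_)
  rw [hderφ y]
  simp only [hSd_eq, hSf]

end StrainPerturbativeBlowup

namespace StrainPerturbativeBlowup

omit [DecidableEq d] in
/-- Squares of smooth scalar functions are smooth (pointwise form). [folklore] -/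
private theorem smooth_sq'' {a : UnitAddTorus d → ℝ} (ha : Torus.IsSmooth a) :
    Torus.IsSmooth (fun y => a y ^ 2) := ha.pow 2

omit [DecidableEq d] in
/-- Constant multiples of smooth scalar functions are smooth (pointwise form). [folklore] -/
private theorem smooth_const_mul'' (c : ℝ) {a : UnitAddTorus d → ℝ} (ha : Torus.IsSmooth a) :
    Torus.IsSmooth (fun y => c * a y) := (Torus.isSmooth_const c).mul ha

omit [DecidableEq d] in
/-- Integrability of a matrix pairing `∑_{ab} F_{ab} G_{ab}` of smooth fields. [folklore] -/
private theorem integrable_sum_mul {F G : d → d → UnitAddTorus d → ℝ} (hF : ∀ a b, Torus.IsSmooth (F a b))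
    (hG : ∀ a b, Torus.IsSmooth (G a b)) :
    Integrable (fun x => ∑ a, ∑ b, F a b x * G a b x) volume :=
  (isSmooth_sum'' _ fun a _ => isSmooth_sum'' _ fun b _ => smooth_mul'' (hF a b) (hG a b)).integrable

/-- **The monotone quantity of Miller's perturbative blow-up argument has nonnegative derivative**
(Anal. PDE 16 (2023), proof of Thm 6.1: with `f(t) = −3‖S‖²_{Ḣ¹} − 4∫det S`,
"`∂ₜf = 6⟨−ΔS + ⅔P_{st}(S²), −ΔS + P_{st}((u·∇)S + S² + ¼ω⊗ω)⟩`" and, by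
"`⟨M, M + Q⟩ = ‖M + ½Q‖² − ¼‖Q‖²`", "`∂ₜf = 6‖−ΔS + P_{st}(½(u·∇)S + ⅚S² + ⅛ω⊗ω)‖² −
(3/2)‖P_{st}((u·∇)S + ⅓S² + ¼ω⊗ω)‖²`"; "Applying the perturbative condition, `∂ₜf(t) ≥ 0`").
Slice form on `T³` with viscosity `ν` (any real): for a smooth divergence-free `v` (frame `e`,
`S_{ab} = ½((∂_a v)_b + (∂_b v)_a)`, `(ΔS)_{ab} = ½((∂_aΔv)_b + (∂_bΔv)_a)`), if
`‖P_{st}((v·∇)S + ⅓S² + ¼ω⊗ω)‖_{L²} ≤ 2‖−νΔS + P_{st}(½(v·∇)S + ⅚S² + ⅛ω⊗ω)‖_{L²}` then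
`−3ν·(−ν‖∇Δv‖² + 2⟨ΔS, P_{st}((v·∇)S + S² + ¾ω⊗ω)⟩) − (4/3)·3⟨νΔS − P_{st}((v·∇)S + S² + ¼ω⊗ω), S²⟩ ≥ 0`
— the two brackets being the derivatives of `‖S‖²_{Ḣ¹} = ½‖Δu‖₂²`
(`IsClassicalNSSolutionOn.hasDerivWithinAt_half_laplacianSq_strainProjection`) and of `∫tr(S³)`
(`hasDerivWithinAt_integral_trace_strain_cube`). [cite: Miller2023StrainModel, Thm 6.1 (proof)] -/
theorem fluxDeriv_nonneg (e : d ≃ Fin 3) {ν : ℝ}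
    {v : UnitAddTorus d → EuclideanSpace ℝ d} (hv : Torus.IsSmooth v) (hdiv : Torus.IsDivFree v)
    (hratio : Real.sqrt (∫ x, ∑ i, ∑ j,
        Torus.strainProjection (fun a b x =>
          (∑ c, v x c * Torus.partialDeriv c
              (fun y => (Torus.partialDeriv b v y a + Torus.partialDeriv a v y b) / 2) x) +
            3⁻¹ * (∑ c, ((Torus.partialDeriv c v x a + Torus.partialDeriv a v x c) / 2) *
              ((Torus.partialDeriv b v x c + Torus.partialDeriv c v x b) / 2)) +
            4⁻¹ * (torusVorticityTensor v (e.symm (e a + 1)) (e.symm (e a + 2)) x *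
              torusVorticityTensor v (e.symm (e b + 1)) (e.symm (e b + 2)) x)) i j x ^ 2) ≤
      2 * Real.sqrt (∫ x, ∑ i, ∑ j,
        (-ν * ((Torus.partialDeriv i (Torus.laplacian v) x j +
            Torus.partialDeriv j (Torus.laplacian v) x i) / 2) +
          Torus.strainProjection (fun a b x =>
            2⁻¹ * (∑ c, v x c * Torus.partialDeriv c
                (fun y => (Torus.partialDeriv b v y a + Torus.partialDeriv a v y b) / 2) x) +
              5 / 6 * (∑ c, ((Torus.partialDeriv c v x a + Torus.partialDeriv a v x c) / 2) *
                ((Torus.partialDeriv b v x c + Torus.partialDeriv c v x b) / 2)) +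
              8⁻¹ * (torusVorticityTensor v (e.symm (e a + 1)) (e.symm (e a + 2)) x *
                torusVorticityTensor v (e.symm (e b + 1)) (e.symm (e b + 2)) x)) i j x) ^ 2)) :
    0 ≤ -(3 * ν) * (-ν * Torus.gradNormSq (Torus.laplacian v) +
        2 * ∫ x, ∑ i, ∑ j, ((Torus.partialDeriv i (Torus.laplacian v) x j +
          Torus.partialDeriv j (Torus.laplacian v) x i) / 2) *
          Torus.strainProjection (Torus.strainPerturbation e v) i j x) -
      4 / 3 * (3 * ∫ x, ∑ i, ∑ j,
        (ν * ((Torus.partialDeriv i (Torus.laplacian v) x j +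
            Torus.partialDeriv j (Torus.laplacian v) x i) / 2) -
          Torus.strainProjection (fun a b x =>
            (∑ c, v x c * Torus.partialDeriv c
                (fun y => (Torus.partialDeriv b v y a + Torus.partialDeriv a v y b) / 2) x) +
              (∑ c, ((Torus.partialDeriv c v x a + Torus.partialDeriv a v x c) / 2) *
                ((Torus.partialDeriv b v x c + Torus.partialDeriv c v x b) / 2)) +
              4⁻¹ * (torusVorticityTensor v (e.symm (e a + 1)) (e.symm (e a + 2)) x *
                torusVorticityTensor v (e.symm (e b + 1)) (e.symm (e b + 2)) x)) i j x) *
        ∑ k, ((Torus.partialDeriv i v x k + Torus.partialDeriv k v x i) / 2) *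
          ((Torus.partialDeriv k v x j + Torus.partialDeriv j v x k) / 2)) := by
  haveI : Nonempty d := ⟨e.symm 0⟩
  -- smoothness of the building blocks
  have hw : Torus.IsSmooth (Torus.laplacian v) := hv.laplacian
  have hvc : ∀ c, Torus.IsSmooth (fun y => v y c) := fun c => hv.apply c
  have hSt : ∀ a b, Torus.IsSmooth (fun y => (Torus.partialDeriv b v y a + Torus.partialDeriv a v y b) / 2) :=
    fun a b => (((hv.partialDeriv b).apply a).add ((hv.partialDeriv a).apply b)).div_const 2
  have hW : ∀ i j, Torus.IsSmooth (torusVorticityTensor v i j) := fun i j =>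
    ((hv.partialDeriv i).apply j).sub ((hv.partialDeriv j).apply i)
  -- the matrix fields
  set LS : d → d → UnitAddTorus d → ℝ := fun a b x =>
    (Torus.partialDeriv a (Torus.laplacian v) x b + Torus.partialDeriv b (Torus.laplacian v) x a) / 2 with hLS
  set T1 : d → d → UnitAddTorus d → ℝ := fun a b x => ∑ c, v x c * Torus.partialDeriv c
    (fun y => (Torus.partialDeriv b v y a + Torus.partialDeriv a v y b) / 2) x with hT1
  set T2 : d → d → UnitAddTorus d → ℝ := fun a b x => ∑ c, ((Torus.partialDeriv c v x a +
    Torus.partialDeriv a v x c) / 2) * ((Torus.partialDeriv b v x c + Torus.partialDeriv c v x b) / 2) with hT2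
  set T2' : d → d → UnitAddTorus d → ℝ := fun i j x => ∑ k, ((Torus.partialDeriv i v x k +
    Torus.partialDeriv k v x i) / 2) * ((Torus.partialDeriv k v x j + Torus.partialDeriv j v x k) / 2) with hT2'
  set Om : d → d → UnitAddTorus d → ℝ := fun a b x =>
    torusVorticityTensor v (e.symm (e a + 1)) (e.symm (e a + 2)) x *
      torusVorticityTensor v (e.symm (e b + 1)) (e.symm (e b + 2)) x with hOm
  set N : d → d → UnitAddTorus d → ℝ := fun a b x => T1 a b x + T2 a b x + 4⁻¹ * Om a b x with hN
  set Qf : d → d → UnitAddTorus d → ℝ := fun a b x => T1 a b x + 3⁻¹ * T2 a b x + 4⁻¹ * Om a b x with hQf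
  set Df : d → d → UnitAddTorus d → ℝ := fun a b x =>
    2⁻¹ * T1 a b x + 5 / 6 * T2 a b x + 8⁻¹ * Om a b x with hDf
  have hT2eq : T2' = T2 := by
    funext i j x
    simp only [hT2, hT2']
    exact Finset.sum_congr rfl fun k _ => by ring
  have hLSs : ∀ a b, Torus.IsSmooth (LS a b) := fun a b =>
    (((hw.partialDeriv a).apply b).add ((hw.partialDeriv b).apply a)).div_const 2
  have hT1s : ∀ a b, Torus.IsSmooth (T1 a b) := fun a b =>
    isSmooth_sum'' _ fun c _ => smooth_mul'' (hvc c) ((hSt a b).partialDeriv c)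
  have hT2s : ∀ a b, Torus.IsSmooth (T2 a b) := fun a b =>
    isSmooth_sum'' _ fun c _ => smooth_mul''
      ((((hv.partialDeriv c).apply a).add ((hv.partialDeriv a).apply c)).div_const 2)
      ((((hv.partialDeriv b).apply c).add ((hv.partialDeriv c).apply b)).div_const 2)
  have hOms : ∀ a b, Torus.IsSmooth (Om a b) := fun a b => smooth_mul'' (hW _ _) (hW _ _)
  have hNs : ∀ a b, Torus.IsSmooth (N a b) := fun a b =>
    ((hT1s a b).add (hT2s a b)).add (smooth_const_mul'' _ (hOms a b))
  have hQfs : ∀ a b, Torus.IsSmooth (Qf a b) := fun a b =>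
    ((hT1s a b).add (smooth_const_mul'' _ (hT2s a b))).add (smooth_const_mul'' _ (hOms a b))
  have hDfs : ∀ a b, Torus.IsSmooth (Df a b) := fun a b =>
    ((smooth_const_mul'' _ (hT1s a b)).add (smooth_const_mul'' _ (hT2s a b))).add
      (smooth_const_mul'' _ (hOms a b))
  have hQt : ∀ a b x, Torus.strainPerturbation e v a b x = N a b x + 2⁻¹ * Om a b x := by
    intro a b x
    have : Torus.strainPerturbation e v a b x = T1 a b x + T2 a b x + 3 / 4 * Om a b x := rfl
    rw [this]; simp only [hN]; ring
  have hQts : ∀ a b, Torus.IsSmooth (Torus.strainPerturbation e v a b) := Torus.isSmooth_strainPerturbation e hv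
  -- projections and their smoothness
  set PN : d → d → UnitAddTorus d → ℝ := Torus.strainProjection N with hPN
  set PT2 : d → d → UnitAddTorus d → ℝ := Torus.strainProjection T2 with hPT2
  have hPNs : ∀ a b, Torus.IsSmooth (PN a b) := Torus.isSmooth_strainProjection hNs
  have hPT2s : ∀ a b, Torus.IsSmooth (PT2 a b) := Torus.isSmooth_strainProjection hT2s
  have hPQts : ∀ a b, Torus.IsSmooth (Torus.strainProjection (Torus.strainPerturbation e v) a b) :=
    Torus.isSmooth_strainProjection hQts
  -- linearity: `P Qf = PN − ⅔ PT2`, `P Df = ½ PN + ⅓ PT2`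
  have hPQf : ∀ a b x, Torus.strainProjection Qf a b x = PN a b x - 2 / 3 * PT2 a b x := by
    intro a b x
    have e1 : Qf = fun a b x => N a b x - (2 / 3) * T2 a b x := by
      funext a b x; simp only [hQf, hN]; ring
    rw [e1, Torus.strainProjection_sub hNs (fun a b => smooth_const_mul'' _ (hT2s a b)),
      Torus.strainProjection_const_mul hT2s]
  have hPDf : ∀ a b x, Torus.strainProjection Df a b x = 2⁻¹ * PN a b x + 3⁻¹ * PT2 a b x := by
    intro a b x
    have e1 : Df = fun a b x => 2⁻¹ * N a b x + 3⁻¹ * T2 a b x := by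
      funext a b x; simp only [hDf, hN]; ring
    rw [e1, Torus.strainProjection_add (fun a b => smooth_const_mul'' _ (hNs a b))
      (fun a b => smooth_const_mul'' _ (hT2s a b)),
      Torus.strainProjection_const_mul hNs, Torus.strainProjection_const_mul hT2s]
  -- `m`, `w = m + q`, `q`
  set m : d → d → UnitAddTorus d → ℝ := fun a b x => -ν * LS a b x + 2 / 3 * PT2 a b x with hm
  set w : d → d → UnitAddTorus d → ℝ := fun a b x => -ν * LS a b x + PN a b x with hwdef
  set q : d → d → UnitAddTorus d → ℝ := fun a b x => PN a b x - 2 / 3 * PT2 a b x with hq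
  have hms : ∀ a b, Torus.IsSmooth (m a b) := fun a b =>
    (smooth_const_mul'' _ (hLSs a b)).add (smooth_const_mul'' _ (hPT2s a b))
  have hws : ∀ a b, Torus.IsSmooth (w a b) := fun a b =>
    (smooth_const_mul'' _ (hLSs a b)).add (hPNs a b)
  have hqs : ∀ a b, Torus.IsSmooth (q a b) := fun a b =>
    (hPNs a b).sub (smooth_const_mul'' _ (hPT2s a b))
  -- (a) `⟨LS, P Q̃⟩ = ⟨LS, N⟩`
  have ha : ∫ x, ∑ a, ∑ b, LS a b x * Torus.strainProjection (Torus.strainPerturbation e v) a b x =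
      ∫ x, ∑ a, ∑ b, LS a b x * N a b x := by
    rw [show (fun x => ∑ a, ∑ b, LS a b x * Torus.strainProjection (Torus.strainPerturbation e v) a b x) =
        fun x => ∑ a, ∑ b, ((Torus.partialDeriv a (Torus.laplacian v) x b +
          Torus.partialDeriv b (Torus.laplacian v) x a) / 2) *
          Torus.strainProjection (Torus.strainPerturbation e v) a b x from rfl,
      integral_sum_laplacianStrain_mul_strainProjection_eq hv hdiv hQts]
    have hpt : ∀ x, ∑ a, ∑ b, ((Torus.partialDeriv a (Torus.laplacian v) x b +
        Torus.partialDeriv b (Torus.laplacian v) x a) / 2) * Torus.strainPerturbation e v a b x =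
        (∑ a, ∑ b, LS a b x * N a b x) + 2⁻¹ * ∑ a, ∑ b,
          torusVorticityTensor v (e.symm (e a + 1)) (e.symm (e a + 2)) x *
          ((Torus.partialDeriv a (Torus.laplacian v) x b + Torus.partialDeriv b (Torus.laplacian v) x a) / 2) *
          torusVorticityTensor v (e.symm (e b + 1)) (e.symm (e b + 2)) x := by
      intro x
      simp only [hQt, hLS, hOm, Finset.mul_sum, ← Finset.sum_add_distrib]
      exact Finset.sum_congr rfl fun a _ => Finset.sum_congr rfl fun b _ => by ring
    simp_rw [hpt]
    rw [integral_add (integrable_sum_mul hLSs hNs)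
      ((isSmooth_sum'' _ fun a _ => isSmooth_sum'' _ fun b _ =>
        smooth_mul'' (smooth_mul'' (hW _ _) (hLSs a b)) (hW _ _)).integrable.const_mul _),
      MeasureTheory.integral_const_mul, integral_sum_vorticity_laplacianStrain_vorticity_eq_zero e hv hdiv,
      mul_zero, add_zero]
  -- (b) `⟨LS, PN⟩ = ⟨LS, N⟩`
  have hb : ∫ x, ∑ a, ∑ b, LS a b x * PN a b x = ∫ x, ∑ a, ∑ b, LS a b x * N a b x :=
    integral_sum_laplacianStrain_mul_strainProjection_eq hv hdiv hNs
  -- (c) `⟨PT2, LS⟩ = ⟨LS, T2⟩`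
  have hc : ∫ x, ∑ a, ∑ b, PT2 a b x * LS a b x = ∫ x, ∑ a, ∑ b, LS a b x * T2 a b x := by
    rw [← integral_sum_laplacianStrain_mul_strainProjection_eq hv hdiv hT2s]
    exact integral_congr_ae (ae_of_all _ fun x =>
      Finset.sum_congr rfl fun a _ => Finset.sum_congr rfl fun b _ => mul_comm _ _)
  -- (d) `⟨PT2, PN⟩ = ⟨PN, T2⟩`
  have hd' : ∫ x, ∑ a, ∑ b, PT2 a b x * PN a b x = ∫ x, ∑ a, ∑ b, PN a b x * T2 a b x := by
    rw [hPT2, Torus.integral_sum_strainProjection_mul_comm hT2s hPNs]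
    refine integral_congr_ae (ae_of_all _ fun x =>
      Finset.sum_congr rfl fun a _ => Finset.sum_congr rfl fun b _ => ?_)
    rw [hPN, Torus.strainProjection_strainProjection hNs, mul_comm]
  -- (e) `∫ΣΣ LS² = ½‖∇Δv‖²`
  have he : ∫ x, ∑ a, ∑ b, LS a b x * LS a b x = 2⁻¹ * Torus.gradNormSq (Torus.laplacian v) := by
    rw [← StrainAlmostEigen.integral_sum_laplacianStrain_sq_eq hv hdiv]
    exact integral_congr_ae (ae_of_all _ fun x =>
      Finset.sum_congr rfl fun a _ => Finset.sum_congr rfl fun b _ => by simp only [hLS]; ring)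
  -- (f) the cubic pairing
  have hf : ∫ x, ∑ i, ∑ j, (ν * LS i j x - PN i j x) * T2' i j x =
      ν * (∫ x, ∑ a, ∑ b, LS a b x * T2 a b x) - ∫ x, ∑ a, ∑ b, PN a b x * T2 a b x := by
    rw [hT2eq]
    have hpt : ∀ x, ∑ i, ∑ j, (ν * LS i j x - PN i j x) * T2 i j x =
        ν * (∑ a, ∑ b, LS a b x * T2 a b x) - ∑ a, ∑ b, PN a b x * T2 a b x := by
      intro x
      simp only [Finset.mul_sum, ← Finset.sum_sub_distrib]
      exact Finset.sum_congr rfl fun a _ => Finset.sum_congr rfl fun b _ => by ring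
    simp_rw [hpt]
    rw [integral_sub ((integrable_sum_mul hLSs hT2s).const_mul ν) (integrable_sum_mul hPNs hT2s),
      MeasureTheory.integral_const_mul]
  -- (g) `∫ΣΣ m w`
  have hg : ∫ x, ∑ a, ∑ b, m a b x * w a b x =
      ν ^ 2 * (∫ x, ∑ a, ∑ b, LS a b x * LS a b x) - ν * (∫ x, ∑ a, ∑ b, LS a b x * PN a b x) -
        2 / 3 * ν * (∫ x, ∑ a, ∑ b, PT2 a b x * LS a b x) +
        2 / 3 * ∫ x, ∑ a, ∑ b, PT2 a b x * PN a b x := by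
    have hpt : ∀ x, ∑ a, ∑ b, m a b x * w a b x =
        ν ^ 2 * (∑ a, ∑ b, LS a b x * LS a b x) - ν * (∑ a, ∑ b, LS a b x * PN a b x) -
          2 / 3 * ν * (∑ a, ∑ b, PT2 a b x * LS a b x) + 2 / 3 * ∑ a, ∑ b, PT2 a b x * PN a b x := by
      intro x
      simp only [hm, hwdef, Finset.mul_sum, ← Finset.sum_sub_distrib, ← Finset.sum_add_distrib]
      exact Finset.sum_congr rfl fun a _ => Finset.sum_congr rfl fun b _ => by ring
    simp_rw [hpt]
    have i1 : Integrable (fun x => ν ^ 2 * ∑ a, ∑ b, LS a b x * LS a b x) volume :=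
      (integrable_sum_mul hLSs hLSs).const_mul (ν ^ 2)
    have i2 : Integrable (fun x => ν * ∑ a, ∑ b, LS a b x * PN a b x) volume :=
      (integrable_sum_mul hLSs hPNs).const_mul ν
    have i3 : Integrable (fun x => 2 / 3 * ν * ∑ a, ∑ b, PT2 a b x * LS a b x) volume :=
      (integrable_sum_mul hPT2s hLSs).const_mul (2 / 3 * ν)
    have i4 : Integrable (fun x => 2 / 3 * ∑ a, ∑ b, PT2 a b x * PN a b x) volume :=
      (integrable_sum_mul hPT2s hPNs).const_mul (2 / 3)
    have i12 : Integrable (fun x => ν ^ 2 * (∑ a, ∑ b, LS a b x * LS a b x) -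
        ν * ∑ a, ∑ b, LS a b x * PN a b x) volume := i1.sub i2
    have i123 : Integrable (fun x => ν ^ 2 * (∑ a, ∑ b, LS a b x * LS a b x) -
        ν * (∑ a, ∑ b, LS a b x * PN a b x) - 2 / 3 * ν * ∑ a, ∑ b, PT2 a b x * LS a b x) volume := i12.sub i3
    rw [integral_add i123 i4, integral_sub i12 i3, integral_sub i1 i2,
      MeasureTheory.integral_const_mul, MeasureTheory.integral_const_mul, MeasureTheory.integral_const_mul,
      MeasureTheory.integral_const_mul]
  -- Claim 1: the flux equals `6∫ΣΣ m w`
  have hclaim1 : -(3 * ν) * (-ν * Torus.gradNormSq (Torus.laplacian v) +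
        2 * ∫ x, ∑ a, ∑ b, LS a b x * Torus.strainProjection (Torus.strainPerturbation e v) a b x) -
      4 / 3 * (3 * ∫ x, ∑ i, ∑ j, (ν * LS i j x - PN i j x) * T2' i j x) =
      6 * ∫ x, ∑ a, ∑ b, m a b x * w a b x := by
    rw [ha, hf, hg, hb, hc, hd', he]
    ring
  -- Claim 2: `6 m w = 6 (m + ½q)² − (3/2) q²` with `w = m + q`
  have hclaim2 : ∫ x, ∑ a, ∑ b, m a b x * w a b x =
      (∫ x, ∑ a, ∑ b, (m a b x + 2⁻¹ * q a b x) ^ 2) - 4⁻¹ * ∫ x, ∑ a, ∑ b, q a b x ^ 2 := by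
    have hpt : ∀ x, ∑ a, ∑ b, m a b x * w a b x =
        (∑ a, ∑ b, (m a b x + 2⁻¹ * q a b x) ^ 2) - 4⁻¹ * ∑ a, ∑ b, q a b x ^ 2 := by
      intro x
      simp only [hm, hwdef, hq, Finset.mul_sum, ← Finset.sum_sub_distrib]
      exact Finset.sum_congr rfl fun a _ => Finset.sum_congr rfl fun b _ => by ring
    simp_rw [hpt]
    have hmq : ∀ a b, Torus.IsSmooth (fun x => m a b x + 2⁻¹ * q a b x) := fun a b =>
      (hms a b).add (smooth_const_mul'' _ (hqs a b))
    rw [integral_sub ((isSmooth_sum'' _ fun a _ => isSmooth_sum'' _ fun b _ => smooth_sq'' (hmq a b)).integrable)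
      ((isSmooth_sum'' _ fun a _ => isSmooth_sum'' _ fun b _ => smooth_sq'' (hqs a b)).integrable.const_mul _),
      MeasureTheory.integral_const_mul]
  -- Claim 3: the hypothesis, squared, in terms of `m`, `q`
  have hq_eq : ∀ a b x, Torus.strainProjection Qf a b x = q a b x := fun a b x => by
    rw [hPQf]
  have hmq_eq : ∀ a b x, -ν * LS a b x + Torus.strainProjection Df a b x = m a b x + 2⁻¹ * q a b x := by
    intro a b x; rw [hPDf]; simp only [hm, hq]; ring
  have hQ0 : 0 ≤ ∫ x, ∑ a, ∑ b, q a b x ^ 2 :=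
    integral_nonneg fun x => Finset.sum_nonneg fun a _ => Finset.sum_nonneg fun b _ => sq_nonneg _
  have hM0 : 0 ≤ ∫ x, ∑ a, ∑ b, (m a b x + 2⁻¹ * q a b x) ^ 2 :=
    integral_nonneg fun x => Finset.sum_nonneg fun a _ => Finset.sum_nonneg fun b _ => sq_nonneg _
  have hratio' : Real.sqrt (∫ x, ∑ a, ∑ b, q a b x ^ 2) ≤
      2 * Real.sqrt (∫ x, ∑ a, ∑ b, (m a b x + 2⁻¹ * q a b x) ^ 2) := by
    have e1 : (fun x => ∑ a, ∑ b, q a b x ^ 2) = fun x => ∑ i, ∑ j, Torus.strainProjection Qf i j x ^ 2 := by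
      funext x; simp only [hq_eq]
    have e2 : (fun x => ∑ a, ∑ b, (m a b x + 2⁻¹ * q a b x) ^ 2) =
        fun x => ∑ i, ∑ j, (-ν * LS i j x + Torus.strainProjection Df i j x) ^ 2 := by
      funext x; simp only [hmq_eq]
    rw [e1, e2]
    exact hratio
  have hsq : ∫ x, ∑ a, ∑ b, q a b x ^ 2 ≤ 4 * ∫ x, ∑ a, ∑ b, (m a b x + 2⁻¹ * q a b x) ^ 2 := by
    have h1 := Real.sqrt_nonneg (∫ x, ∑ a, ∑ b, q a b x ^ 2)
    have h2 := mul_self_le_mul_self h1 hratio'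
    rw [← pow_two, Real.sq_sqrt hQ0] at h2
    calc ∫ x, ∑ a, ∑ b, q a b x ^ 2 ≤ (2 * Real.sqrt (∫ x, ∑ a, ∑ b, (m a b x + 2⁻¹ * q a b x) ^ 2)) *
          (2 * Real.sqrt (∫ x, ∑ a, ∑ b, (m a b x + 2⁻¹ * q a b x) ^ 2)) := h2
      _ = 4 * (Real.sqrt (∫ x, ∑ a, ∑ b, (m a b x + 2⁻¹ * q a b x) ^ 2) ^ 2) := by ring
      _ = 4 * ∫ x, ∑ a, ∑ b, (m a b x + 2⁻¹ * q a b x) ^ 2 := by rw [Real.sq_sqrt hM0]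
  rw [hclaim1, hclaim2]
  linarith

end StrainPerturbativeBlowup

namespace StrainPerturbativeBlowup

variable {ν T : ℝ} {u : ℝ → UnitAddTorus d → EuclideanSpace ℝ d} {p : ℝ → UnitAddTorus d → ℝ}

/-- `∫ det S = ⅓ ∫ tr(S³)` on `T³` for the strain of a smooth divergence-free field, in the entry
conventions of this file (tree: `integral_stretching_eq_four_mul_integral_det_strain`
and `…_four_thirds_integral_trace_strain_cube`, Miller APDE 2023 "`det(S) = ⅓ tr(S³)`" for
trace-free symmetric `S`). [cite: Miller2023StrainModel, Thm 6.1 (proof: `∫det S = ⅓∫tr(S³)`)] -/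
theorem four_mul_integral_det_strain_eq (e : d ≃ Fin 3) {v : UnitAddTorus d → EuclideanSpace ℝ d}
    (hv : Torus.IsSmooth v) (hdiv : Torus.IsDivFree v) :
    4 * ∫ x, Matrix.det (Matrix.of fun i j =>
        (Torus.partialDeriv j v x i + Torus.partialDeriv i v x j) / 2) =
      4 / 3 * ∫ x, ∑ i, ∑ j, ∑ k,
        ((Torus.partialDeriv i v x j + Torus.partialDeriv j v x i) / 2) *
        ((Torus.partialDeriv j v x k + Torus.partialDeriv k v x j) / 2) *
        ((Torus.partialDeriv k v x i + Torus.partialDeriv i v x k) / 2) := by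
  have hd : Fintype.card d = 3 := by rw [Fintype.card_congr e, Fintype.card_fin]
  rw [← integral_stretching_eq_four_mul_integral_det_strain hd hv hdiv,
    integral_stretching_eq_four_thirds_integral_trace_strain_cube hd hv hdiv]
  congr 1
  refine integral_congr_ae (ae_of_all _ fun x => ?_)
  exact Finset.sum_congr rfl fun i _ => Finset.sum_congr rfl fun j _ =>
    Finset.sum_congr rfl fun k _ => by ring

/-- **Miller's perturbative blow-up condition for Navier–Stokes, on `T³`** (Anal. PDE 16 (2023),
Thm 6.1 = Pure Appl. Anal. 8 (2026), Thm 1.10: "Suppose `u ∈ C([0,T_max);H²_{df})` is a mild solution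
of the Navier–Stokes equation such that `f₀ = −3‖S⁰‖²_{Ḣ¹} − 4∫det(S⁰) > 0`, and for all
`0 ≤ t < T_max`,
`‖P_{st}((u·∇)S + ⅓S² + ¼ω⊗ω)‖_{L²} / ‖−ΔS + P_{st}(½(u·∇)S + ⅚S² + ⅛ω⊗ω)‖_{L²} ≤ 2`. Then there is
finite-time blowup with `T_max < T_* = (−E₀ + √(E₀² + f₀K₀))/f₀`, `K₀ = ½‖u⁰‖²_{L²}`,
`E₀ = ½‖∇u⁰‖²_{L²}`").
Quantitative form of the printed proof, for CLASSICAL solutions of the unforced equations with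
viscosity `ν ≥ 0` on a closed interval `[0, T] × T^d` (`card d = 3`, frame `e`): if the ratio
hypothesis holds on `[0, T]` (with `−νΔS` in the denominator), then
`K(T) + 2ν(E₀T + ½f₀T²) ≤ K₀`, where `f₀ = −3ν‖S⁰‖²_{Ḣ¹} − 4∫det S⁰` (`‖S⁰‖²_{Ḣ¹} = ½‖Δu₀‖₂²`),
`E₀ = torusEnstrophy(u₀) = ½‖∇u₀‖₂²`, `K = Torus.kineticEnergy = ½‖u‖₂²`. Printed proof followed:
`f(t) = −3ν‖S‖²_{Ḣ¹} − (4/3)∫tr(S³)` has `∂ₜf ≥ 0` (`fluxDeriv_nonneg`), the enstrophy identity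
`∂ₜE = −2ν‖S‖²_{Ḣ¹} − 4∫det S ≥ f ≥ f₀` gives `E(t) ≥ E₀ + f₀t`, and the energy identity
`∂ₜK = −2νE`. No sign hypothesis on `f₀` is needed for this inequality; for `f₀ > 0` it bounds `T`
(`Torus.classicalNS_time_le_of_strainPerturbative`). [cite: Miller2023StrainModel, Thm 6.1; Miller2026StrainVorticity, Thm 1.10] -/
theorem _root_.Literature.Analysis.FluidPDE.Torus.classicalNS_kineticEnergy_add_le_of_strainPerturbative
    (e : d ≃ Fin 3) (hν : 0 ≤ ν) (hT : 0 < T)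
    (h : Torus.IsClassicalNSSolutionOn (Icc 0 T) ν 0 u p) {f₀ : ℝ}
    (hf₀ : f₀ = -(3 * ν) * (2⁻¹ * ∫ x, ‖Torus.laplacian (u 0) x‖ ^ 2) -
      4 * ∫ x, Matrix.det (Matrix.of fun i j =>
        (Torus.partialDeriv j (u 0) x i + Torus.partialDeriv i (u 0) x j) / 2))
    (hratio : ∀ t ∈ Icc 0 T, Real.sqrt (∫ x, ∑ i, ∑ j,
        Torus.strainProjection (fun a b x =>
          (∑ c, u t x c * Torus.partialDeriv c
              (fun y => (Torus.partialDeriv b (u t) y a + Torus.partialDeriv a (u t) y b) / 2) x) +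
            3⁻¹ * (∑ c, ((Torus.partialDeriv c (u t) x a + Torus.partialDeriv a (u t) x c) / 2) *
              ((Torus.partialDeriv b (u t) x c + Torus.partialDeriv c (u t) x b) / 2)) +
            4⁻¹ * (torusVorticityTensor (u t) (e.symm (e a + 1)) (e.symm (e a + 2)) x *
              torusVorticityTensor (u t) (e.symm (e b + 1)) (e.symm (e b + 2)) x)) i j x ^ 2) ≤
      2 * Real.sqrt (∫ x, ∑ i, ∑ j,
        (-ν * ((Torus.partialDeriv i (Torus.laplacian (u t)) x j +
            Torus.partialDeriv j (Torus.laplacian (u t)) x i) / 2) +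
          Torus.strainProjection (fun a b x =>
            2⁻¹ * (∑ c, u t x c * Torus.partialDeriv c
                (fun y => (Torus.partialDeriv b (u t) y a + Torus.partialDeriv a (u t) y b) / 2) x) +
              5 / 6 * (∑ c, ((Torus.partialDeriv c (u t) x a + Torus.partialDeriv a (u t) x c) / 2) *
                ((Torus.partialDeriv b (u t) x c + Torus.partialDeriv c (u t) x b) / 2)) +
              8⁻¹ * (torusVorticityTensor (u t) (e.symm (e a + 1)) (e.symm (e a + 2)) x *
                torusVorticityTensor (u t) (e.symm (e b + 1)) (e.symm (e b + 2)) x)) i j x) ^ 2)) :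
    Torus.kineticEnergy (u T) + 2 * ν * (torusEnstrophy (u 0) * T + 2⁻¹ * f₀ * T ^ 2) ≤
      Torus.kineticEnergy (u 0) := by
  have hd : Fintype.card d = 3 := by rw [Fintype.card_congr e, Fintype.card_fin]
  -- the three functionals
  set X : ℝ → ℝ := fun s => 2⁻¹ * ∫ x, ‖Torus.laplacian (u s) x‖ ^ 2 with hX
  set C : ℝ → ℝ := fun s => ∫ x, ∑ i, ∑ j, ∑ k,
    ((Torus.partialDeriv i (u s) x j + Torus.partialDeriv j (u s) x i) / 2) *
    ((Torus.partialDeriv j (u s) x k + Torus.partialDeriv k (u s) x j) / 2) *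
    ((Torus.partialDeriv k (u s) x i + Torus.partialDeriv i (u s) x k) / 2) with hC
  set E : ℝ → ℝ := fun s => torusEnstrophy (u s) with hE
  set K : ℝ → ℝ := fun s => Torus.kineticEnergy (u s) with hK
  set f : ℝ → ℝ := fun s => -(3 * ν) * X s - 4 / 3 * C s with hf
  have hus : ∀ s ∈ Icc 0 T, Torus.IsSmooth (u s) := fun s hs => h.smooth_velocity.isSmooth_slice hs
  have hX0 : ∀ s, 0 ≤ X s := fun s => mul_nonneg (by norm_num) (integral_nonneg fun x => sq_nonneg _)
  -- `4∫det S = (4/3) C`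
  have hdet : ∀ s ∈ Icc 0 T, 4 * ∫ x, Matrix.det (Matrix.of fun i j =>
      (Torus.partialDeriv j (u s) x i + Torus.partialDeriv i (u s) x j) / 2) = 4 / 3 * C s :=
    fun s hs => four_mul_integral_det_strain_eq e (hus s hs) (h.divFree s hs)
  have hf0 : f 0 = f₀ := by
    rw [hf₀, hdet 0 ⟨le_rfl, hT.le⟩]
  -- derivative flux of `X` and `C`
  set X' : ℝ → ℝ := fun s => -ν * Torus.gradNormSq (Torus.laplacian (u s)) +
    2 * ∫ x, ∑ i, ∑ j, ((Torus.partialDeriv i (Torus.laplacian (u s)) x j +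
      Torus.partialDeriv j (Torus.laplacian (u s)) x i) / 2) *
      Torus.strainProjection (Torus.strainPerturbation e (u s)) i j x with hX'
  set C' : ℝ → ℝ := fun s => 3 * ∫ x, ∑ i, ∑ j,
    (ν * ((Torus.partialDeriv i (Torus.laplacian (u s)) x j +
        Torus.partialDeriv j (Torus.laplacian (u s)) x i) / 2) -
      Torus.strainProjection (fun a b x =>
        (∑ c, u s x c * Torus.partialDeriv c
            (fun y => (Torus.partialDeriv b (u s) y a + Torus.partialDeriv a (u s) y b) / 2) x) +
          (∑ c, ((Torus.partialDeriv c (u s) x a + Torus.partialDeriv a (u s) x c) / 2) *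
            ((Torus.partialDeriv b (u s) x c + Torus.partialDeriv c (u s) x b) / 2)) +
          4⁻¹ * (torusVorticityTensor (u s) (e.symm (e a + 1)) (e.symm (e a + 2)) x *
            torusVorticityTensor (u s) (e.symm (e b + 1)) (e.symm (e b + 2)) x)) i j x) *
    ∑ k, ((Torus.partialDeriv i (u s) x k + Torus.partialDeriv k (u s) x i) / 2) *
      ((Torus.partialDeriv k (u s) x j + Torus.partialDeriv j (u s) x k) / 2) with hC'
  have hXd : ∀ s ∈ Icc 0 T, HasDerivWithinAt X (X' s) (Icc 0 T) s :=
    fun s hs => h.hasDerivWithinAt_half_laplacianSq_strainProjection hd e hT hs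
  have hCd : ∀ s ∈ Icc 0 T, HasDerivWithinAt C (C' s) (Icc 0 T) s :=
    fun s hs => hasDerivWithinAt_integral_trace_strain_cube e h hT hs
  have hfd : ∀ s ∈ Icc 0 T, HasDerivWithinAt f (-(3 * ν) * X' s - 4 / 3 * C' s) (Icc 0 T) s :=
    fun s hs => ((hXd s hs).const_mul _).sub ((hCd s hs).const_mul _)
  have hf' : ∀ s ∈ Icc 0 T, 0 ≤ -(3 * ν) * X' s - 4 / 3 * C' s :=
    fun s hs => fluxDeriv_nonneg e (hus s hs) (h.divFree s hs) (hratio s hs)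
  -- Step 1: `f` is non-decreasing, `f s ≥ f 0 = f₀`
  have hfmono : ∀ t ∈ Icc 0 T, f 0 ≤ f t := by
    intro t ht
    have hder : ∀ s ∈ Icc 0 T, HasDerivWithinAt (fun r => -f r) (-(-(3 * ν) * X' s - 4 / 3 * C' s))
        (Icc 0 T) s := fun s hs => (hfd s hs).neg
    have hle : ∀ s ∈ Icc 0 T, -(-(3 * ν) * X' s - 4 / 3 * C' s) ≤ 0 * (-f s) := by
      intro s hs; rw [zero_mul]; linarith [hf' s hs]
    have hmain := le_mul_exp_integral_of_hasDerivWithinAt_le_mul hT hder continuousOn_const hle ht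
    rw [intervalIntegral.integral_zero, Real.exp_zero, mul_one] at hmain
    linarith
  -- Step 2: enstrophy, `E' = −2νX − (4/3)C ≥ f ≥ f₀`, hence `E t ≥ E 0 + f₀ t`
  have hEd : ∀ s ∈ Icc 0 T, HasDerivWithinAt E (-(2 * ν) * X s - 4 / 3 * C s) (Icc 0 T) s := by
    intro s hs
    have h1 := h.hasDerivWithinAt_torusEnstrophy_det hd hT hs
    refine h1.congr_deriv ?_
    rw [← hdet s hs]
    simp only [hX]
    ring
  have hElow : ∀ t ∈ Icc 0 T, E 0 + f₀ * t ≤ E t := by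
    intro t ht
    have hder : ∀ s ∈ Icc 0 T, HasDerivWithinAt (fun r => E 0 + f₀ * r - E r)
        (f₀ * 1 - (-(2 * ν) * X s - 4 / 3 * C s)) (Icc 0 T) s := by
      intro s hs
      have h1 : HasDerivWithinAt (fun r => E 0 + f₀ * r) (f₀ * 1) (Icc 0 T) s :=
        ((hasDerivWithinAt_id s (Icc 0 T)).const_mul f₀).const_add (E 0)
      exact h1.sub (hEd s hs)
    have hle : ∀ s ∈ Icc 0 T, f₀ * 1 - (-(2 * ν) * X s - 4 / 3 * C s) ≤ 0 * (E 0 + f₀ * s - E s) := by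
      intro s hs
      rw [zero_mul]
      have h1 := hfmono s hs
      rw [hf0] at h1
      have h2 : f s = -(3 * ν) * X s - 4 / 3 * C s := rfl
      have h3 : 0 ≤ ν * X s := mul_nonneg hν (hX0 s)
      linarith
    have hmain := le_mul_exp_integral_of_hasDerivWithinAt_le_mul hT hder continuousOn_const hle ht
    rw [intervalIntegral.integral_zero, Real.exp_zero, mul_one] at hmain
    simp only [mul_zero, add_zero, sub_self] at hmain
    linarith
  -- Step 3: energy, `Ψ(s) = K s + 2ν(E₀ s + ½ f₀ s²)` is non-increasing
  have hKd : ∀ s ∈ Icc 0 T, HasDerivWithinAt K (-ν * Torus.gradNormSq (u s)) (Icc 0 T) s := by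
    intro s hs
    have hb := Torus.IsClassicalNSSolutionOn.energy_balance_holds h (convex_Icc 0 T) hs
    simpa using hb
  have hgrad : ∀ s, Torus.gradNormSq (u s) = 2 * E s := by
    intro s; simp only [hE, torusEnstrophy]; ring
  have hΨ : K T + 2 * ν * (E 0 * T + 2⁻¹ * f₀ * T ^ 2) ≤ K 0 := by
    have hder : ∀ s ∈ Icc 0 T, HasDerivWithinAt (fun r => K r + 2 * ν * (E 0 * r + 2⁻¹ * f₀ * r ^ 2))
        (-ν * Torus.gradNormSq (u s) + 2 * ν * (E 0 * 1 + 2⁻¹ * f₀ * (2 * s ^ 1 * 1))) (Icc 0 T) s := by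
      intro s hs
      have h1 : HasDerivWithinAt (fun r => E 0 * r + 2⁻¹ * f₀ * r ^ 2)
          (E 0 * 1 + 2⁻¹ * f₀ * (2 * s ^ 1 * 1)) (Icc 0 T) s :=
        ((hasDerivWithinAt_id s (Icc 0 T)).const_mul (E 0)).add
          (((hasDerivWithinAt_id s (Icc 0 T)).pow 2).const_mul (2⁻¹ * f₀))
      exact (hKd s hs).add (h1.const_mul (2 * ν))
    have hle : ∀ s ∈ Icc 0 T, -ν * Torus.gradNormSq (u s) + 2 * ν * (E 0 * 1 + 2⁻¹ * f₀ * (2 * s ^ 1 * 1)) ≤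
        0 * (K s + 2 * ν * (E 0 * s + 2⁻¹ * f₀ * s ^ 2)) := by
      intro s hs
      rw [zero_mul, hgrad s]
      have h1 := hElow s hs
      nlinarith
    have hmain := le_mul_exp_integral_of_hasDerivWithinAt_le_mul hT hder continuousOn_const hle
      ⟨hT.le, le_rfl⟩
    rw [intervalIntegral.integral_zero, Real.exp_zero, mul_one] at hmain
    simpa using hmain
  exact hΨ

/-- **The blow-up time bound of Miller's perturbative condition** (Anal. PDE 16 (2023), Thm 6.1 /
Pure Appl. Anal. 8 (2026), Thm 1.10: "`T_max < T_* = (−E₀ + √(E₀² + f₀K₀))/f₀`"): under the hypotheses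
of `Torus.classicalNS_kineticEnergy_add_le_of_strainPerturbative` with `ν > 0` and `f₀ > 0`, the
length `T` of the closed existence interval satisfies `T ≤ (−E₀ + √(E₀² + f₀K₀/ν))/f₀`
(`= T_*` at `ν = 1`; a classical solution on a CLOSED interval `[0, T]` with `T > T_*` carrying the
hypothesis throughout cannot exist; the printed strict inequality refers to the half-open maximal
interval). [cite: Miller2023StrainModel, Thm 6.1; Miller2026StrainVorticity, Thm 1.10] -/
theorem _root_.Literature.Analysis.FluidPDE.Torus.classicalNS_time_le_of_strainPerturbative
    (e : d ≃ Fin 3) (hν : 0 < ν) (hT : 0 < T)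
    (h : Torus.IsClassicalNSSolutionOn (Icc 0 T) ν 0 u p) {f₀ : ℝ} (hf₀pos : 0 < f₀)
    (hf₀ : f₀ = -(3 * ν) * (2⁻¹ * ∫ x, ‖Torus.laplacian (u 0) x‖ ^ 2) -
      4 * ∫ x, Matrix.det (Matrix.of fun i j =>
        (Torus.partialDeriv j (u 0) x i + Torus.partialDeriv i (u 0) x j) / 2))
    (hratio : ∀ t ∈ Icc 0 T, Real.sqrt (∫ x, ∑ i, ∑ j,
        Torus.strainProjection (fun a b x =>
          (∑ c, u t x c * Torus.partialDeriv c
              (fun y => (Torus.partialDeriv b (u t) y a + Torus.partialDeriv a (u t) y b) / 2) x) +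
            3⁻¹ * (∑ c, ((Torus.partialDeriv c (u t) x a + Torus.partialDeriv a (u t) x c) / 2) *
              ((Torus.partialDeriv b (u t) x c + Torus.partialDeriv c (u t) x b) / 2)) +
            4⁻¹ * (torusVorticityTensor (u t) (e.symm (e a + 1)) (e.symm (e a + 2)) x *
              torusVorticityTensor (u t) (e.symm (e b + 1)) (e.symm (e b + 2)) x)) i j x ^ 2) ≤
      2 * Real.sqrt (∫ x, ∑ i, ∑ j,
        (-ν * ((Torus.partialDeriv i (Torus.laplacian (u t)) x j +
            Torus.partialDeriv j (Torus.laplacian (u t)) x i) / 2) +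
          Torus.strainProjection (fun a b x =>
            2⁻¹ * (∑ c, u t x c * Torus.partialDeriv c
                (fun y => (Torus.partialDeriv b (u t) y a + Torus.partialDeriv a (u t) y b) / 2) x) +
              5 / 6 * (∑ c, ((Torus.partialDeriv c (u t) x a + Torus.partialDeriv a (u t) x c) / 2) *
                ((Torus.partialDeriv b (u t) x c + Torus.partialDeriv c (u t) x b) / 2)) +
              8⁻¹ * (torusVorticityTensor (u t) (e.symm (e a + 1)) (e.symm (e a + 2)) x *
                torusVorticityTensor (u t) (e.symm (e b + 1)) (e.symm (e b + 2)) x)) i j x) ^ 2)) :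
    T ≤ (-torusEnstrophy (u 0) + Real.sqrt (torusEnstrophy (u 0) ^ 2 +
        f₀ * Torus.kineticEnergy (u 0) / ν)) / f₀ := by
  have hmain := Torus.classicalNS_kineticEnergy_add_le_of_strainPerturbative e hν.le hT h hf₀ hratio
  set E₀ : ℝ := torusEnstrophy (u 0) with hE₀
  set K₀ : ℝ := Torus.kineticEnergy (u 0) with hK₀
  have hKT : 0 ≤ Torus.kineticEnergy (u T) := Torus.kineticEnergy_nonneg _
  have hE0 : 0 ≤ E₀ := torusEnstrophy_nonneg _
  -- `ν f₀ T² + 2ν E₀ T ≤ K₀`, i.e. `(f₀T + E₀)² ≤ E₀² + f₀K₀/ν`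
  have h1 : f₀ * T ^ 2 + 2 * E₀ * T ≤ K₀ / ν := by
    rw [le_div_iff₀ hν]
    nlinarith
  have h2 : (f₀ * T + E₀) ^ 2 ≤ E₀ ^ 2 + f₀ * K₀ / ν := by
    have : (f₀ * T + E₀) ^ 2 = f₀ * (f₀ * T ^ 2 + 2 * E₀ * T) + E₀ ^ 2 := by ring
    rw [this, mul_div_assoc]
    nlinarith [mul_le_mul_of_nonneg_left h1 hf₀pos.le]
  have h3 : f₀ * T + E₀ ≤ Real.sqrt (E₀ ^ 2 + f₀ * K₀ / ν) := by
    have h0 : 0 ≤ f₀ * T + E₀ := by positivity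
    calc f₀ * T + E₀ = Real.sqrt ((f₀ * T + E₀) ^ 2) := (Real.sqrt_sq h0).symm
      _ ≤ Real.sqrt (E₀ ^ 2 + f₀ * K₀ / ν) := Real.sqrt_le_sqrt h2
  rw [le_div_iff₀ hf₀pos]
  linarith

end StrainPerturbativeBlowup

end Literature.Analysis.FluidPDE
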